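import Mathlib.Analysis.Calculus.BumpFunction.InnerProduct
import Summits.SmoothPoincare4.SmoothPoincare4.Theorems.DottedCircleRasmussenDcrGapHelperFriendsCarrierVkPartAFrameExt
import Summits.SmoothPoincare4.SmoothPoincare4.Theorems.DottedCircleRasmussenDcrGapHelperFriendsCarrierVkPartAAngleLift
import Summits.SmoothPoincare4.SmoothPoincare4.Theorems.DottedCircleRasmussenDcrGapHelperFriendsCarrierVkPartABoundaryFrame
import Summits.SmoothPoincare4.SmoothPoincare4.Theorems.DottedCircleRasmussenDcrGapHelperFriendsCarrierVkPartACoeff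
import Literature.Topology.FourManifolds.NormalFrameTransport

/-!
# Helper `helper_friendsCarrier_Vk_partA_of_framingInput` (piece 5 of the registered stub
`helper_friendsCarrier_Vk_partA`, line `mk_friends`, skeleton v8) for crux `DcrGap`
(item stmt-SmoothPoincare4-16128, route route-SmoothPoincare4-DottedCircleRasmussen)

**Part A of V_k (the framing theorem) from its topological input.**  The registered Part A asks for a
`C^∞` transversal framing `(n₀, n₁)` of the neat model slice disc `f₁` over the closed unit disc with
PRESCRIBED boundary values `bᵢ(u) = ∂_{wᵢ}|₀ νK(u, ·)`, the fibre derivatives of a tube `νK` of the model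
knot inside `M_k`.  This file proves it from the one statement in which the homological hypotheses
(`IsNullHomologous`, the picture `0`-framing) are consumed, the **framing input**: for every transversal
framing `(m₀, m₁)` of `f₁` over the closed disc and every decomposition `b₀ = df₁ v + a m₀ + c m₁` along the
circle with continuous `a, c`, the loop `a + i c` is freely null-homotopic in `ℂ ∖ 0` ("the tube framing is
the disc framing").  Construction (differential topology only):

1. a `C^∞` frame `(m₀, m₁)` of the normal bundle of `f₁` near the closed disc (tree: `exists_normalFrame`,
   transport along rays), cut off to global `C^∞` fields;
2. the boundary values are transversal to the disc at the circle by neatness, and extend radially to `C^∞`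
   fields off the origin (`…VkPartABoundaryFrame`); their coefficients `bᵢ = df₁ vᵢ + Σⱼ Aⱼᵢ mⱼ` in the frame
   are `C^∞` (`…VkPartACoeff`, Cramer), with `det A ≠ 0` of constant sign on the circle (transversality,
   connectedness);
3. the framing input makes the first column `(a, c)` of `A` null-homotopic, whence a `C^∞` polar angle of
   its radial extension (`…VkPartAAngleLift`, homotopy lifting through `exp`);
4. the Gram–Schmidt formula of `…VkPartAFrameExt` extends `A` to a field `Ã` of invertible matrices over the
   whole plane, and `nᵢ = df₁(Ṽᵢ) + Σⱼ Ãⱼᵢ mⱼ` (with any `C^∞` extensions `Ṽᵢ` of the tangential coefficients)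
   is the framing: transversal wherever `(m₀, m₁)` is, equal to `bᵢ` on the circle.

* `helper_friendsCarrier_Vk_partA_of_framingInput` — the registered statement.

No definitions, no named facts, no `sorry`.

## References

* A. A. Kosinski, *Differential Manifolds* (1993), Ch. III (4.1)–(4.2). [Kosinski1993]
* M. W. Hirsch, *Differential Topology*, GTM 33 (1976), Ch. 4 §2 Cor. 2.5, §5 Thm. 5.1. [Hirsch1976]
* A. Hatcher, *Algebraic Topology*, CUP (2002), §3.D, Prop. 1.30. [HatcherAT2002]
-/

-- the prescribed namespace `Summit.<P>.<Sub>.…` duplicates `SmoothPoincare4` (P = Sub)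
set_option linter.dupNamespace false
set_option linter.style.longLine false

noncomputable section

open scoped Manifold ContDiff Topology RealInnerProductSpace
open Set Function Metric Filter
open Literature.Topology.FourManifolds Literature.Topology.FourManifolds.MMSW

namespace Summit.SmoothPoincare4.SmoothPoincare4.Theorems.DcrGap.MkFriends

namespace FriendsCarrierVk

/-! ## Small tools -/

/-- **Cutting off a locally smooth field to a global one**: `χ • g` is `C^∞` on `ℝ²` when `g` is `C^∞` on
an open ball containing the support of the bump `χ`. [folklore] -/
theorem contDiff_bump_smul {g : EuclideanSpace ℝ (Fin 2) → EuclideanSpace ℝ (Fin 4)} {R : ℝ}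
    (χ : ContDiffBump (0 : EuclideanSpace ℝ (Fin 2))) (hR : χ.rOut < R) (hg : ContDiffOn ℝ ∞ g (ball 0 R)) :
    ContDiff ℝ ∞ fun x => χ x • g x := by
  rw [contDiff_iff_contDiffAt]
  intro x
  by_cases hx : x ∈ ball (0 : EuclideanSpace ℝ (Fin 2)) R
  · exact χ.contDiff.contDiffAt.smul (hg.contDiffAt (isOpen_ball.mem_nhds hx))
  · have hx' : x ∉ tsupport χ := by
      rw [χ.tsupport_eq]
      intro h
      exact hx (mem_ball_zero_iff.2 (lt_of_le_of_lt (mem_closedBall_zero_iff.1 (by simpa using h)) hR))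
    have hev : (χ : EuclideanSpace ℝ (Fin 2) → ℝ) =ᶠ[𝓝 x] 0 := notMem_tsupport_iff_eventuallyEq.1 hx'
    have hev' : (fun x => χ x • g x) =ᶠ[𝓝 x] fun _ => 0 := by
      filter_upwards [hev] with y hy
      rw [hy, Pi.zero_apply, zero_smul]
    exact (contDiffAt_const (c := (0 : EuclideanSpace ℝ (Fin 4)))).congr_of_eventuallyEq hev'

/-- The radial projection, as a plane-valued map, is `C^∞` off the origin. [folklore] -/
theorem contDiffAt_coe_radialProjection (u₀ : sphere (0 : EuclideanSpace ℝ (Fin 2)) 1) {x : EuclideanSpace ℝ (Fin 2)} (hx : x ≠ 0) :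
    ContDiffAt ℝ ∞ (fun y : EuclideanSpace ℝ (Fin 2) => ((radialProjection u₀ y : sphere (0 : EuclideanSpace ℝ (Fin 2)) 1) : EuclideanSpace ℝ (Fin 2))) x := by
  have hev : (fun y : EuclideanSpace ℝ (Fin 2) => ((radialProjection u₀ y : sphere (0 : EuclideanSpace ℝ (Fin 2)) 1) : EuclideanSpace ℝ (Fin 2))) =ᶠ[𝓝 x]
      fun y => ‖y‖⁻¹ • y := by
    filter_upwards [isOpen_ne.mem_nhds hx] with y hy
    exact coe_radialProjection_of_ne_zero u₀ hy
  exact (((contDiffAt_norm ℝ hx).inv (norm_ne_zero_iff.2 hx)).smul contDiffAt_id).congr_of_eventuallyEq hev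

/-- The radial projection is constant along open rays. [folklore] -/
theorem radialProjection_inv_norm_smul (u₀ : sphere (0 : EuclideanSpace ℝ (Fin 2)) 1) {x : EuclideanSpace ℝ (Fin 2)} (hx : x ≠ 0) :
    radialProjection u₀ (‖x‖⁻¹ • x) = radialProjection u₀ x := by
  have h : ‖x‖⁻¹ • x = (1 : ℝ) • ((radialProjection u₀ x : sphere (0 : EuclideanSpace ℝ (Fin 2)) 1) : EuclideanSpace ℝ (Fin 2)) := by
    rw [one_smul]; exact (coe_radialProjection_of_ne_zero u₀ hx).symm
  rw [h]
  exact radialProjection_smul u₀ one_pos _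

/-- **`φ • g` is globally `C^∞` for a plane field `g` smooth off the origin** (the plateau
`φ = smoothTransition (3|x|² - 1)` vanishes near the origin). [folklore] -/
theorem contDiff_plateau_smul {g : EuclideanSpace ℝ (Fin 2) → EuclideanSpace ℝ (Fin 2)} (hg : ∀ x, x ≠ 0 → ContDiffAt ℝ ∞ g x) :
    ContDiff ℝ ∞ fun x => Real.smoothTransition (3 * ‖x‖ ^ 2 - 1) • g x := by
  rw [contDiff_iff_contDiffAt]
  intro x
  by_cases hx : x = 0
  · subst hx
    have hev : (fun x : EuclideanSpace ℝ (Fin 2) => Real.smoothTransition (3 * ‖x‖ ^ 2 - 1) • g x) =ᶠ[𝓝 0] fun _ => 0 := by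
      filter_upwards [ball_mem_nhds (0 : EuclideanSpace ℝ (Fin 2)) (by norm_num : (0 : ℝ) < 1 / 2)] with y hy
      rw [plateau_eq_zero (mem_ball_zero_iff.1 hy), zero_smul]
    exact (contDiffAt_const (c := (0 : EuclideanSpace ℝ (Fin 2)))).congr_of_eventuallyEq hev
  · exact contDiff_plateau.contDiffAt.smul (hg x hx)

/-- **A `2 × 2` matrix whose columns annihilate only the trivial combination has non-zero determinant.**
[folklore] -/
theorem det_ne_zero_of_columns {a b c d : ℝ} (h : ∀ α β : ℝ, α * a + β * b = 0 → α * c + β * d = 0 → α = 0 ∧ β = 0) :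
    a * d - b * c ≠ 0 := by
  intro hdet
  by_cases hcd : c = 0 ∧ d = 0
  · obtain ⟨hc, hd⟩ := hcd
    by_cases hab : a = 0 ∧ b = 0
    · have := h 1 0 (by rw [hab.1]; ring) (by rw [hc]; ring)
      exact one_ne_zero this.1
    · have := h b (-a) (by ring) (by rw [hc, hd]; ring)
      rcases not_and_or.1 hab with ha | hb
      · exact ha (by linarith [this.2])
      · exact hb this.1
  · have := h d (-c) (by linarith) (by ring)
    rcases not_and_or.1 hcd with hc | hd
    · exact hc (by linarith [this.2])
    · exact hd this.1

/-- **A continuous nowhere-zero function on the circle has constant sign.** [folklore] -/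
theorem exists_sign_of_ne_zero {δ : EuclideanSpace ℝ (Fin 2) → ℝ} (hδc : ContinuousOn δ (sphere 0 1))
    (hδ : ∀ u ∈ sphere (0 : EuclideanSpace ℝ (Fin 2)) 1, δ u ≠ 0) :
    ∃ ε : ℝ, (ε = 1 ∨ ε = -1) ∧ ∀ u ∈ sphere (0 : EuclideanSpace ℝ (Fin 2)) 1, 0 < ε * δ u := by
  have hconn : IsPreconnected (sphere (0 : EuclideanSpace ℝ (Fin 2)) 1) := by
    refine isPreconnected_sphere ?_ 0 1
    rw [← Module.finrank_eq_rank]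
    simp
  let u₀ : EuclideanSpace ℝ (Fin 2) := EuclideanSpace.single 0 1
  have hu₀ : u₀ ∈ sphere (0 : EuclideanSpace ℝ (Fin 2)) 1 := by simp [u₀]
  rcases lt_or_gt_of_ne (hδ u₀ hu₀) with hneg | hpos
  · refine ⟨-1, Or.inr rfl, fun u hu => ?_⟩
    rcases lt_or_gt_of_ne (hδ u hu) with h | h
    · linarith
    · exfalso
      obtain ⟨w, hw, hw0⟩ := hconn.intermediate_value₂ hu₀ hu hδc continuousOn_const hneg.le h.le
      exact hδ w hw hw0
  · refine ⟨1, Or.inl rfl, fun u hu => ?_⟩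
    rcases lt_or_gt_of_ne (hδ u hu) with h | h
    · exfalso
      obtain ⟨w, hw, hw0⟩ := hconn.intermediate_value₂ hu hu₀ hδc continuousOn_const h.le hpos.le
      exact hδ w hw hw0
    · linarith

end FriendsCarrierVk

open FriendsCarrierVk in
/-- **Helper `helper_friendsCarrier_Vk_partA_of_framingInput`** (Part A of V_k from its framing input).  For a
neat model slice disc `f₁` of the model knot `K₁` and a tube `νK : 𝕊¹ × ℝ² → M_k` of `K₁` (`C^∞` immersion,
`νK(u, 0) = K₁ u`), IF for every `C^∞` pair `(m₀, m₁)` transversal to `f₁` over the closed unit disc and every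
decomposition `∂_{w₀}|₀ νK(u, ·) = df₁(u) v(u) + a(u) m₀(u) + c(u) m₁(u)` along the circle with continuous
`a, c` the loop `a + i c` is freely null-homotopic in `ℂ ∖ 0`, THEN the fibre derivatives of `νK` along the
circle extend to a `C^∞` transversal framing `(n₀, n₁)` of `f₁` over the closed unit disc.
[cite: Kosinski1993, Ch. III Thm (4.2)] [cite: HatcherAT2002, §3.D] -/
theorem helper_friendsCarrier_Vk_partA_of_framingInput : ∀ (k : ℕ) (K₁ : (sphere (0 : EuclideanSpace ℝ (Fin 2)) 1) → EuclideanSpace ℝ (Fin 4)) (f₁ : EuclideanSpace ℝ (Fin 2) → EuclideanSpace ℝ (Fin 4)) (νK : (sphere (0 : EuclideanSpace ℝ (Fin 2)) 1) × EuclideanSpace ℝ (Fin 2) → EuclideanSpace ℝ (Fin 4)), IsModelKnot k K₁ → IsModelSliceDisc k K₁ f₁ → (∀ t : (sphere (0 : EuclideanSpace ℝ (Fin 2)) 1), deriv (fun ρ : ℝ => levelFun k (f₁ (ρ • (t : EuclideanSpace ℝ (Fin 2))))) 1 < 0) → ContMDiff ((𝓡 1).prod 𝓘(ℝ, EuclideanSpace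 ℝ (Fin 2))) 𝓘(ℝ, EuclideanSpace ℝ (Fin 4)) ∞ νK → (∀ p, Injective (mfderiv ((𝓡 1).prod 𝓘(ℝ, EuclideanSpace ℝ (Fin 2))) 𝓘(ℝ, EuclideanSpace ℝ (Fin 4)) νK p)) → (∀ p, νK p ∈ modelBoundary k) → (∀ u : (sphere (0 : EuclideanSpace ℝ (Fin 2)) 1), νK (u, 0) = K₁ u) → (∀ (m₀ m₁ : EuclideanSpace ℝ (Fin 2) → EuclideanSpace ℝ (Fin 4)) (a c : (sphere (0 : EuclideanSpace ℝ (Fin 2)) 1) → ℝ) (v : (sphere (0 : EuclideanSpace ℝ (Fin 2)) 1) → EuclideanSpace ℝ (Fin 2)), ContDiff ℝ ∞ m₀ → ContDiff ℝ ∞ m₁ → (∀ x ∈ closedBall (0 : EuclideanSpace ℝ (Fin 2)) 1, ∀ (e : EuclideanSpace ℝ (Fin 2)) (α β : ℝ), fderiv ℝ f₁ x e + α • m₀ x + β • m₁ x = 0 → e = 0 ∧ α = 0 ∧ β = 0) → Continuous a → Continuous c → (∀ u : (sphere (0 : EuclideanSpace ℝ (Fin 2)) 1), fderiv ℝ (fun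 w : EuclideanSpace ℝ (Fin 2) => νK (u, w)) 0 (EuclideanSpace.single 0 1) = fderiv ℝ f₁ u (v u) + a u • m₀ u + c u • m₁ u) → ∃ H : unitInterval × (sphere (0 : EuclideanSpace ℝ (Fin 2)) 1) → ℂ, Continuous H ∧ (∀ p, H p ≠ 0) ∧ (∀ u, H (0, u) = (a u : ℂ) + (c u : ℂ) * Complex.I) ∧ ∃ z : ℂ, ∀ u, H (1, u) = z) → ∃ n₀ n₁ : EuclideanSpace ℝ (Fin 2) → EuclideanSpace ℝ (Fin 4), ContDiff ℝ ∞ n₀ ∧ ContDiff ℝ ∞ n₁ ∧ (∀ x ∈ closedBall (0 : EuclideanSpace ℝ (Fin 2)) 1, ∀ (v : EuclideanSpace ℝ (Fin 2)) (a b : ℝ), fderiv ℝ f₁ x v + a • n₀ x + b • n₁ x = 0 → v = 0 ∧ a = 0 ∧ b = 0) ∧ (∀ u : (sphere (0 : EuclideanSpace ℝ (Fin 2)) 1), n₀ u = fderiv ℝ (fun w : EuclideanSpace ℝ (Fin 2) => νK (u, w)) 0 (EuclideanSpace.single 0 1) ∧ n₁ u = fderiv ℝ (fun w : EuclideanSpace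 ℝ (Fin 2) => νK (u, w)) 0 (EuclideanSpace.single 1 1)) := by
  intro k K₁ f₁ νK _hK hf hneat hν hνimm hνM hν0 hHom
  have hfs : ContDiff ℝ ∞ f₁ := contMDiff_iff_contDiff.1 hf.1
  have himm : ∀ x ∈ closedBall (0 : EuclideanSpace ℝ (Fin 2)) 1, Injective (fderiv ℝ f₁ x) := fun x hx => by
    have h := hf.2.2.1 x hx
    rwa [mfderiv_eq_fderiv] at h
  ------------------------------------------------------------------
  -- Step 1: a normal frame near the closed disc, cut off to global fields
  ------------------------------------------------------------------
  obtain ⟨R', n, hR', himm', hns, hnP, hnli⟩ :=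
    exists_normalFrame hfs (finrank_euclideanSpace_fin (𝕜 := ℝ) (n := 4)) one_pos himm
  have htrn : ∀ x ∈ ball (0 : EuclideanSpace ℝ (Fin 2)) R', ∀ (e : EuclideanSpace ℝ (Fin 2)) (α β : ℝ),
      fderiv ℝ f₁ x e + α • n 0 x + β • n 1 x = 0 → e = 0 ∧ α = 0 ∧ β = 0 := by
    intro x hx e α β h
    have htr := (transversal_iff_linearIndependent_normProj (himm' x hx) (fun i => n i x)).2 (by
      have heq : (fun i => normProj (fderiv ℝ f₁ x) (n i x)) = fun i => n i x := funext fun i => hnP x hx i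
      rw [heq]; exact hnli x hx)
    obtain ⟨he, ha⟩ := htr e (!₂[α, β]) (by rw [Fin.sum_univ_two]; simpa [add_assoc] using h)
    exact ⟨he, by simpa using congrArg (fun z : EuclideanSpace ℝ (Fin 2) => z 0) ha,
      by simpa using congrArg (fun z : EuclideanSpace ℝ (Fin 2) => z 1) ha⟩
  have horth : ∀ x ∈ ball (0 : EuclideanSpace ℝ (Fin 2)) R', ∀ i, ∀ e : EuclideanSpace ℝ (Fin 2), ⟪fderiv ℝ f₁ x e, n i x⟫ = 0 :=
    fun x hx i => (normProj_eq_self_iff (himm' x hx) (n i x)).1 (hnP x hx i)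
  -- radii `1 < R₁ < R₂ < R'` and the bump
  set R₁ : ℝ := (2 + R') / 3 with hR₁
  set R₂ : ℝ := (1 + 2 * R') / 3 with hR₂
  have h1R₁ : 1 < R₁ := by rw [hR₁]; linarith
  have hR₁₂ : R₁ < R₂ := by rw [hR₁, hR₂]; linarith
  have hR₂' : R₂ < R' := by rw [hR₂]; linarith
  let χ : ContDiffBump (0 : EuclideanSpace ℝ (Fin 2)) := ⟨R₁, R₂, by linarith, hR₁₂⟩
  set m : Fin 2 → EuclideanSpace ℝ (Fin 2) → EuclideanSpace ℝ (Fin 4) := fun i x => χ x • n i x with hm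
  have hms : ∀ i, ContDiff ℝ ∞ (m i) := fun i => contDiff_bump_smul χ hR₂' (hns i)
  have hmn : ∀ i, ∀ x ∈ closedBall (0 : EuclideanSpace ℝ (Fin 2)) R₁, m i x = n i x := fun i x hx => by
    simp only [hm]
    rw [χ.one_of_mem_closedBall (by simpa using hx), one_smul]
  have hsub₁ : closedBall (0 : EuclideanSpace ℝ (Fin 2)) R₁ ⊆ ball 0 R' := closedBall_subset_ball (by linarith)
  have htrm : ∀ x ∈ closedBall (0 : EuclideanSpace ℝ (Fin 2)) R₁, ∀ (e : EuclideanSpace ℝ (Fin 2)) (α β : ℝ),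
      fderiv ℝ f₁ x e + α • m 0 x + β • m 1 x = 0 → e = 0 ∧ α = 0 ∧ β = 0 := fun x hx e α β h => by
    rw [hmn 0 x hx, hmn 1 x hx] at h
    exact htrn x (hsub₁ hx) e α β h
  have horthm : ∀ x ∈ closedBall (0 : EuclideanSpace ℝ (Fin 2)) R₁, ∀ i, ∀ e : EuclideanSpace ℝ (Fin 2), ⟪fderiv ℝ f₁ x e, m i x⟫ = 0 :=
    fun x hx i e => by rw [hmn i x hx]; exact horth x (hsub₁ hx) i e
  ------------------------------------------------------------------
  -- Step 2: boundary data, radially extended, and their coefficients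
  ------------------------------------------------------------------
  obtain ⟨htrb, hbs⟩ := helper_friendsCarrier_Vk_partA_boundaryFrame k K₁ f₁ νK hf hneat hν hνimm hνM hν0
  let u₀ : sphere (0 : EuclideanSpace ℝ (Fin 2)) 1 := ⟨EuclideanSpace.single 0 1, by simp⟩
  set bb : Fin 2 → EuclideanSpace ℝ (Fin 2) → EuclideanSpace ℝ (Fin 4) := fun i y =>
    fderiv ℝ (fun w : EuclideanSpace ℝ (Fin 2) => νK (radialProjection u₀ y, w)) 0 (EuclideanSpace.single i 1) with hbb
  have hbbs : ∀ i, ∀ x, x ≠ 0 → ContDiffAt ℝ ∞ (bb i) x := fun i x hx => hbs u₀ (EuclideanSpace.single i 1) x hx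
  have hbbu : ∀ i, ∀ u : sphere (0 : EuclideanSpace ℝ (Fin 2)) 1,
      bb i u = fderiv ℝ (fun w : EuclideanSpace ℝ (Fin 2) => νK (u, w)) 0 (EuclideanSpace.single i 1) := fun i u => by
    simp only [hbb, radialProjection_coe_sphere]
  -- the set where the coefficients live
  set U : Set (EuclideanSpace ℝ (Fin 2)) := {x | x ≠ 0} ∩ ball 0 R₁ with hU
  have hUo : IsOpen U := isOpen_ne.inter isOpen_ball
  have hUsub : U ⊆ closedBall 0 R₁ := fun x hx => ball_subset_closedBall hx.2
  have hsphU : ∀ u : sphere (0 : EuclideanSpace ℝ (Fin 2)) 1, (u : EuclideanSpace ℝ (Fin 2)) ∈ U := fun u =>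
    ⟨ne_zero_of_mem_unit_sphere u, mem_ball_zero_iff.2 (by rw [norm_eq_of_mem_sphere u]; exact h1R₁)⟩
  have hcoef : ∀ i, ∃ (v : EuclideanSpace ℝ (Fin 2) → EuclideanSpace ℝ (Fin 2)) (α₀ α₁ : EuclideanSpace ℝ (Fin 2) → ℝ),
      (∀ x ∈ U, ContDiffAt ℝ ∞ v x ∧ ContDiffAt ℝ ∞ α₀ x ∧ ContDiffAt ℝ ∞ α₁ x) ∧
      ∀ x ∈ U, bb i x = fderiv ℝ f₁ x (v x) + α₀ x • m 0 x + α₁ x • m 1 x := fun i =>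
    helper_friendsCarrier_Vk_partA_coeff f₁ (m 0) (m 1) (bb i) U hfs hUo (fun x _ => (hms 0).contDiffAt)
      (fun x _ => (hms 1).contDiffAt) (fun x hx => hbbs i x hx.1) (fun x hx => htrm x (hUsub hx))
      (fun x hx => horthm x (hUsub hx) 0) (fun x hx => horthm x (hUsub hx) 1)
  obtain ⟨v₀, a, c, hs₀, hdec₀⟩ := hcoef 0
  obtain ⟨v₁, b, d, hs₁, hdec₁⟩ := hcoef 1
  ------------------------------------------------------------------
  -- Step 3: `det A ≠ 0` of constant sign on the circle
  ------------------------------------------------------------------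
  have hdet : ∀ u ∈ sphere (0 : EuclideanSpace ℝ (Fin 2)) 1, a u * d u - b u * c u ≠ 0 := by
    intro u hu
    refine det_ne_zero_of_columns fun α β h1 h2 => ?_
    let u' : sphere (0 : EuclideanSpace ℝ (Fin 2)) 1 := ⟨u, hu⟩
    have e0 := hdec₀ u (hsphU u')
    have e1 := hdec₁ u (hsphU u')
    rw [hbbu 0 u'] at e0
    rw [hbbu 1 u'] at e1
    have key' : fderiv ℝ f₁ u (-(α • v₀ u + β • v₁ u)) + α • fderiv ℝ (fun w : EuclideanSpace ℝ (Fin 2) => νK (u', w)) 0 (EuclideanSpace.single 0 1) +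
        β • fderiv ℝ (fun w : EuclideanSpace ℝ (Fin 2) => νK (u', w)) 0 (EuclideanSpace.single 1 1) = 0 := by
      rw [e0, e1, map_neg, map_add, map_smul, map_smul]
      have expand : -(α • fderiv ℝ f₁ u (v₀ u) + β • fderiv ℝ f₁ u (v₁ u)) +
          α • (fderiv ℝ f₁ u (v₀ u) + a u • m 0 u + c u • m 1 u) + β • (fderiv ℝ f₁ u (v₁ u) + b u • m 0 u + d u • m 1 u) =
          (α * a u + β * b u) • m 0 u + (α * c u + β * d u) • m 1 u := by
        simp only [smul_add, smul_smul, add_smul, neg_add]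
        abel
      rw [expand, h1, h2, zero_smul, zero_smul, add_zero]
    have := htrb u' _ α β key'
    exact ⟨this.2.1, this.2.2⟩
  have hcontU : ∀ {g : EuclideanSpace ℝ (Fin 2) → ℝ}, (∀ x ∈ U, ContDiffAt ℝ ∞ g x) → ContinuousOn g (sphere 0 1) :=
    fun hg x hx => (hg x (hsphU ⟨x, hx⟩)).continuousAt.continuousWithinAt
  have has : ∀ x ∈ U, ContDiffAt ℝ ∞ a x := fun x hx => (hs₀ x hx).2.1
  have hcs : ∀ x ∈ U, ContDiffAt ℝ ∞ c x := fun x hx => (hs₀ x hx).2.2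
  have hbs' : ∀ x ∈ U, ContDiffAt ℝ ∞ b x := fun x hx => (hs₁ x hx).2.1
  have hds : ∀ x ∈ U, ContDiffAt ℝ ∞ d x := fun x hx => (hs₁ x hx).2.2
  have hv₀s : ∀ x ∈ U, ContDiffAt ℝ ∞ v₀ x := fun x hx => (hs₀ x hx).1
  have hv₁s : ∀ x ∈ U, ContDiffAt ℝ ∞ v₁ x := fun x hx => (hs₁ x hx).1
  obtain ⟨ε, hε, hεdet⟩ := exists_sign_of_ne_zero (δ := fun x => a x * d x - b x * c x)
    ((((hcontU has).mul (hcontU hds)).sub ((hcontU hbs').mul (hcontU hcs)))) hdet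
  ------------------------------------------------------------------
  -- Step 4: the framing input — a null-homotopy of `a + ic` — and the polar angle
  ------------------------------------------------------------------
  obtain ⟨H, hHc, hH0, hHa, z, hHz⟩ := hHom (m 0) (m 1) (fun u => a u) (fun u => c u) (fun u => v₀ u) (hms 0) (hms 1)
    (fun x hx => htrm x (closedBall_subset_closedBall h1R₁.le hx))
    (continuous_iff_continuousAt.2 fun u => (has u (hsphU u)).continuousAt.comp continuous_subtype_val.continuousAt)
    (continuous_iff_continuousAt.2 fun u => (hcs u (hsphU u)).continuousAt.comp continuous_subtype_val.continuousAt)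
    (fun u => by rw [← hbbu 0 u]; exact hdec₀ u (hsphU u))
  -- radial extensions
  set π : EuclideanSpace ℝ (Fin 2) → EuclideanSpace ℝ (Fin 2) := fun x =>
    ((radialProjection u₀ x : sphere (0 : EuclideanSpace ℝ (Fin 2)) 1) : EuclideanSpace ℝ (Fin 2)) with hπ
  have hπs : ∀ x, x ≠ 0 → ContDiffAt ℝ ∞ π x := fun x hx => contDiffAt_coe_radialProjection u₀ hx
  have hπU : ∀ x, π x ∈ U := fun x => hsphU _
  have hπu : ∀ u : sphere (0 : EuclideanSpace ℝ (Fin 2)) 1, π u = u := fun u => by simp only [hπ, radialProjection_coe_sphere]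
  have hπrad : ∀ x, x ≠ 0 → π (‖x‖⁻¹ • x) = π x := fun x hx => by simp only [hπ, radialProjection_inv_norm_smul u₀ hx]
  have hrad : ∀ {g : EuclideanSpace ℝ (Fin 2) → ℝ}, (∀ x ∈ U, ContDiffAt ℝ ∞ g x) → ∀ x, x ≠ 0 → ContDiffAt ℝ ∞ (fun y => g (π y)) x :=
    fun hg x hx => (hg _ (hπU x)).comp x (hπs x hx)
  set g : EuclideanSpace ℝ (Fin 2) → ℂ := fun x => ((a (π x) : ℝ) : ℂ) + ((c (π x) : ℝ) : ℂ) * Complex.I with hg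
  have hgs : ∀ x, x ≠ 0 → ContDiffAt ℝ ∞ g x := fun x hx =>
    (Complex.ofRealCLM.contDiff.contDiffAt.comp x (hrad has x hx)).add
      ((Complex.ofRealCLM.contDiff.contDiffAt.comp x (hrad hcs x hx)).mul contDiffAt_const)
  have hgu : ∀ u : sphere (0 : EuclideanSpace ℝ (Fin 2)) 1, g u = (a u : ℂ) + (c u : ℂ) * Complex.I := fun u => by
    simp only [hg, hπu]
  have hg0 : ∀ x, x ≠ 0 → g x ≠ 0 := fun x hx => by
    have h := hH0 (0, radialProjection u₀ x)
    rw [hHa] at h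
    exact h
  have hgrad : ∀ x, x ≠ 0 → g x = g (‖x‖⁻¹ • x) := fun x hx => by simp only [hg, hπrad x hx]
  obtain ⟨θ, hθs, hpol⟩ := helper_friendsCarrier_Vk_partA_angleLift g hgs hg0 hgrad
    ⟨H, hHc, hH0, fun u => by rw [hHa, hgu], z, hHz⟩
  -- the modulus and the polar form of `a ∘ π`, `c ∘ π`
  set r : EuclideanSpace ℝ (Fin 2) → ℝ := fun x => ‖g x‖ with hr
  have hrs : ∀ x, x ≠ 0 → ContDiffAt ℝ ∞ r x := fun x hx => (hgs x hx).norm ℝ (hg0 x hx)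
  have hrpos : ∀ x, x ≠ 0 → 0 < r x := fun x hx => norm_pos_iff.2 (hg0 x hx)
  have hare : ∀ x, (g x).re = a (π x) := fun x => by simp [hg]
  have hcim : ∀ x, (g x).im = c (π x) := fun x => by simp [hg]
  have hapol : ∀ x, x ≠ 0 → a (π x) = r x * Real.cos (θ x) := fun x hx => by
    rw [← hare, hpol x hx, Complex.re_ofReal_mul, Complex.exp_ofReal_mul_I_re]
  have hcpol : ∀ x, x ≠ 0 → c (π x) = r x * Real.sin (θ x) := fun x hx => by
    rw [← hcim, hpol x hx, Complex.im_ofReal_mul, Complex.exp_ofReal_mul_I_im]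
  ------------------------------------------------------------------
  -- Step 5: the frame extension and the tangential extensions
  ------------------------------------------------------------------
  obtain ⟨A, B, C, D, hAs, hBs, hCs, hDs, hdetE, hbdry⟩ :=
    helper_friendsCarrier_Vk_partA_frameExt (fun x => a (π x)) (fun x => b (π x)) (fun x => c (π x)) (fun x => d (π x)) r θ ε hε
      (hrad hbs') (hrad hds) hrs hθs hrpos hapol hcpol (fun x _ => hεdet (π x) (radialProjection u₀ x).2)
  set V₀ : EuclideanSpace ℝ (Fin 2) → EuclideanSpace ℝ (Fin 2) := fun x => Real.smoothTransition (3 * ‖x‖ ^ 2 - 1) • v₀ (π x) with hV₀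
  set V₁ : EuclideanSpace ℝ (Fin 2) → EuclideanSpace ℝ (Fin 2) := fun x => Real.smoothTransition (3 * ‖x‖ ^ 2 - 1) • v₁ (π x) with hV₁
  have hV₀s : ContDiff ℝ ∞ V₀ := contDiff_plateau_smul fun x hx => (hv₀s _ (hπU x)).comp x (hπs x hx)
  have hV₁s : ContDiff ℝ ∞ V₁ := contDiff_plateau_smul fun x hx => (hv₁s _ (hπU x)).comp x (hπs x hx)
  have hV₀u : ∀ u : sphere (0 : EuclideanSpace ℝ (Fin 2)) 1, V₀ u = v₀ u := fun u => by
    simp only [hV₀, plateau_eq_one (norm_eq_of_mem_sphere u), one_smul, hπu]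
  have hV₁u : ∀ u : sphere (0 : EuclideanSpace ℝ (Fin 2)) 1, V₁ u = v₁ u := fun u => by
    simp only [hV₁, plateau_eq_one (norm_eq_of_mem_sphere u), one_smul, hπu]
  ------------------------------------------------------------------
  -- Step 6: the framing
  ------------------------------------------------------------------
  have hdf : ContDiff ℝ ∞ (fderiv ℝ f₁) := hfs.fderiv_right (m := ∞) (by simp)
  clear_value V₀ V₁ m bb π r g U
  refine ⟨fun x => fderiv ℝ f₁ x (V₀ x) + A x • m 0 x + C x • m 1 x,
    fun x => fderiv ℝ f₁ x (V₁ x) + B x • m 0 x + D x • m 1 x,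
    ((hdf.clm_apply hV₀s).add (hAs.smul (hms 0))).add (hCs.smul (hms 1)),
    ((hdf.clm_apply hV₁s).add (hBs.smul (hms 0))).add (hDs.smul (hms 1)), fun x hx e α β h => ?_, fun u => ?_⟩
  · -- transversality on the closed unit disc
    have hx₁ : x ∈ closedBall (0 : EuclideanSpace ℝ (Fin 2)) R₁ := closedBall_subset_closedBall h1R₁.le hx
    have h' : fderiv ℝ f₁ x (e + α • V₀ x + β • V₁ x) + (α * A x + β * B x) • m 0 x + (α * C x + β * D x) • m 1 x = 0 := by
      rw [← h]
      simp only [map_add, map_smul, smul_add, smul_smul, add_smul]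
      abel
    obtain ⟨he, h1, h2⟩ := htrm x hx₁ _ _ _ h'
    have hD := hdetE x
    have hα : α = 0 := by
      have : α * (A x * D x - B x * C x) = D x * (α * A x + β * B x) - B x * (α * C x + β * D x) := by ring
      rw [h1, h2, mul_zero, mul_zero, sub_zero] at this
      exact (mul_eq_zero.1 this).resolve_right hD
    have hβ : β = 0 := by
      have : β * (A x * D x - B x * C x) = A x * (α * C x + β * D x) - C x * (α * A x + β * B x) := by ring
      rw [h1, h2, mul_zero, mul_zero, sub_zero] at this
      exact (mul_eq_zero.1 this).resolve_right hD
    refine ⟨?_, hα, hβ⟩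
    rw [hα, hβ, zero_smul, zero_smul, add_zero, add_zero] at he
    exact he
  · -- boundary values
    obtain ⟨hA, hB, hC, hD⟩ := hbdry u (norm_eq_of_mem_sphere u)
    simp only [hA, hB, hC, hD, hV₀u, hV₁u, hπu]
    exact ⟨by rw [← hbbu 0 u]; exact (hdec₀ u (hsphU u)).symm, by rw [← hbbu 1 u]; exact (hdec₁ u (hsphU u)).symm⟩

end Summit.SmoothPoincare4.SmoothPoincare4.Theorems.DcrGap.MkFriends

end
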